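import Summits.ABC.IUTFork.Repair.RHReqsideWeightLawsSignTierL1Datum
import Summits.ABC.IUTFork.Repair.RHHullCellSlice
import HarnessLib

/-!
# D-0122 AXIS B, knob k1 — THE TYPED FORM, part 3h: the «seg» column under a modified pilot law — DOWNWARD CLOSURE of the k1-cell is a THEOREM for
# laws growing at least like print (`Δf(j)·j ≥ 2(f(j) − 1)`: print, `κ = 3`, affine `c ≥ 1`) and FAILS for the light laws `κ = 1`, `κ = 3/2` at explicit
# tame-type integer data — which is why `T`, `K_L0`, `DD` were typed segment-free (parts 3a/3f)

abc-iut cell, rung LADDER-ABC:A2.RESCUE.H; seat abc-iut-reqb-typ-1 (GEN 3; D-0122 axis B typer k1/k4; R69 (A1) hardening queue); owner abc-iut-rh-lead g4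
(`plan/rescue/R-H/ROUND3/REQB-SPEC.md` v0.2 §1 «`j₀(w) = #{j : margin_j ≥ 0}` (seg = 1 iff these are `{1..j₀}`)», §3 column «seg violations»); table of record
`REQB-TABLE.tsv` v1 b8ac679ede5d795b (every k1 row: seg violations 0 on the bed — an ENGINE fact about the tabulated data). Print's downward closure is
abc-iut-rh2-w-2's `RH.HullCellSlice.hullCellδ_of_succ` / `hullCellδ_anti` (local-field hypotheses `e − 1 ≤ δ`, `r_out ≤ r_in`, `m ≥ 0`). Parts 3a–3g =
p516945 … p522952 (this seat). Nothing re-typed.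
* §1 `not_cell_succ_of_not_cell` — **DOWNWARD CLOSURE FOR HEAVY LAWS** (`den = 1`; `0 < e`, `e − 1 ≤ δ`, `r_out ≤ r_in`, `0 ≤ m`, `1 ≤ j`): if the law's
  increment at `j` satisfies `0 ≤ Δf := f(j+1) − f(j)` and **`Δf·j ≥ 2·(f(j) − 1)`**, then failure at `j` propagates to `j + 1`. (Failure at `j` forces
  `(f(j) − 1)m ≥ jδ + (j+1)G + 1`, whence `Δf·m ≥ 2δ + G ≥ δ + G + (e − 1)`, which is what the floor needs: `e⌊(X+Δ)/e⌋ ≥ e⌊X/e⌋ + Δ − (e−1)`.) Instances: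
  PRINT `j²` (`(2j+1)j ≥ 2(j²−1)`; = rh2-w-2's theorem, re-derived in the `Cell` currency: `cell_sq_of_succ`), `κ = 3` (`lawPow 6 = j³`: `(3j²+3j+1)j ≥ 2(j³−1)`),
  AFFINE `c ≥ 1` (`c(2j+1)j ≥ 2(cj²−1)`) — for these rows «seg = 1» is a THEOREM at every place a local field can present, and `j₀(w)` is a true cutoff.
* §2 **NON-SEGMENT WITNESSES FOR THE LIGHT LAWS** (tame-type integers `δ = e − 1`, `r_in = 1`, `r_out < 0`, `m ≥ 0`, by `decide`): `κ = 1` at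
  `(e, m, δ, r_in, r_out) = (7, 13, 6, 1, −3)`: labels `1 … 5` IN, `6` OUT, `7` IN (`kappaOne_not_downward_closed`); `κ = 3/2` at `(13, 11, 12, 1, −3)`: `1, 2` IN,
  `3` OUT, `4` IN (`kappaThreeHalves_not_downward_closed`; `⌈3^{3/2}⌉ = 6`, `⌈4^{3/2}⌉ = 8` by certificates). So for `κ < 2` the increment condition fails
  (`κ = 1`: `j ≥ 2(j−1)` only for `j ≤ 2`) AND closure itself fails: «seg = 1» for rows S-k1-kappa1 / S-k1-kappa3/2 (and their pairs) is a property of the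
  TABULATED BED (engines: 0 violations on 1,531 places), not of the law — the reason parts 3a/3f typed `offDemand` / `keptDemand` / `exactDeficit` over the
  licensed SET, with no segment assumption, and part 3a's `offDemand_eq_of_boundary` takes the segment shape as an explicit hypothesis.
  NOT DECIDED HERE: shift `a ≥ 1` (increment condition holds only for `j ≤ 6` at `a = 1`) and `κ = 5/2` (ceilings) — the bed reports 0 violations; no claim.
HONEST FRAMING: integer arithmetic about OUR typed cell with a free pilot law (a PARAMETER — REQB-SPEC FRAMING); the witnesses are integers, not places of
the bed; nothing here asserts that abc is proved or refuted, or that [IUTchIII] Cor. 3.12 / [IUTchIV] Thm. 1.10 holds or fails at any datum, or takes a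
side on any author; typed ≠ proved; computed ≠ proved. [claim: Mochizuki2012, status: disputed] for every IUT locution.
[cite: Mochizuki2012, IUTchIV Prop. 1.2 (i)(ii) p. 10, Prop. 1.4 p. 13] [cite: SerreLocalFields1979, Ch. III §6 Prop. 13]
-/

noncomputable section

open Finset

namespace Summit.ABC.IUTFork.Repair.RH.ReqsideWeightLaws

open Summit.ABC.IUTFork.Repair.RH.DiffPricedHull Summit.ABC.IUTFork.Repair.RH.HullCellSlice

/-! ## §1. Downward closure for laws growing at least like print -/

/-- **FAILURE PROPAGATES UPWARD under a heavy law** (`den = 1`; local-field hypotheses `0 < e`, `e − 1 ≤ δ`, `r_out ≤ r_in`, `0 ≤ m`; label `j ≥ 1`;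
increment `Δf = f(j+1) − f(j) ≥ 0` with `Δf·j ≥ 2(f(j) − 1)`): `¬ Cell_j ⟹ ¬ Cell_{j+1}`. Generalises abc-iut-rh2-w-2's
`HullCellSlice.not_hullCellδ_succ_of_not_hullCellδ` (print) to every such law. [folklore] -/
theorem not_cell_succ_of_not_cell {f : ℕ → ℤ} {e m δ rin rout : ℤ} (he : 0 < e) (hδ : e - 1 ≤ δ) (hio : rout ≤ rin) (hm : 0 ≤ m)
    {j : ℕ} (hj : 1 ≤ j) (hinc0 : 0 ≤ f (j + 1) - f j) (hinc : 2 * (f j - 1) ≤ (f (j + 1) - f j) * (j : ℤ))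
    (h : ¬ Cell f 1 e m δ rin rout j) : ¬ Cell f 1 e m δ rin rout (j + 1) := by
  -- failure at `j` in linear form: `(f(j) − 1)m ≥ jδ + (j+1)G + 1`
  have hlin : (j : ℤ) * δ + ((j : ℤ) + 1) * (rin - rout) < (f j - 1) * m := by
    by_contra hle
    exact h (cell_of_linear one_pos he (by push Not at hle; linarith))
  have hj' : (1 : ℤ) ≤ (j : ℤ) := by exact_mod_cast hj
  have hδ0 : 0 ≤ δ := by linarith
  have hG0 : 0 ≤ rin - rout := by linarith
  -- hence `f(j) ≥ 2` (else the left side `≥ 0` could not be `< 0`)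
  have hf2 : 2 ≤ f j := by
    by_contra hlt
    push Not at hlt
    have : (f j - 1) * m ≤ 0 := by nlinarith
    nlinarith [mul_nonneg (by linarith : (0 : ℤ) ≤ (j : ℤ)) hδ0, mul_nonneg (by linarith : (0 : ℤ) ≤ (j : ℤ) + 1) hG0]
  -- the increment estimate `Δf·m ≥ 2δ + G`
  have hΔ : 2 * δ + (rin - rout) ≤ (f (j + 1) - f j) * m := by
    -- multiply `hlin` by `Δf ≥ 0` and compare with `(f j − 1)(2δ + G)` using `Δf·j ≥ 2(f j − 1)`, `Δf·(j+1) ≥ f j − 1`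
    have h1 : (f (j + 1) - f j) * ((j : ℤ) * δ + ((j : ℤ) + 1) * (rin - rout)) ≤ (f (j + 1) - f j) * ((f j - 1) * m) :=
      mul_le_mul_of_nonneg_left hlin.le hinc0
    have h2 : (f j - 1) * (2 * δ) ≤ (f (j + 1) - f j) * ((j : ℤ) * δ) := by nlinarith [mul_le_mul_of_nonneg_right hinc hδ0]
    have hinc' : f j - 1 ≤ (f (j + 1) - f j) * ((j : ℤ) + 1) := by nlinarith
    have h3 : (f j - 1) * (rin - rout) ≤ (f (j + 1) - f j) * (((j : ℤ) + 1) * (rin - rout)) := by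
      nlinarith [mul_le_mul_of_nonneg_right hinc' hG0]
    have h4 : (f j - 1) * (2 * δ + (rin - rout)) ≤ (f j - 1) * ((f (j + 1) - f j) * m) := by nlinarith
    exact le_of_mul_le_mul_left h4 (by linarith)
  -- floor bookkeeping
  intro hc
  unfold Cell at h hc
  push Not at h
  simp only [one_mul, Nat.cast_add, Nat.cast_one] at h hc
  set X : ℤ := f j * m - ((j : ℤ) * δ + ((j : ℤ) + 1) * rin) with hX
  set Δ : ℤ := (f (j + 1) - f j) * m - δ - rin with hΔ'
  have hX' : f (j + 1) * m - (((j : ℤ) + 1) * δ + ((j : ℤ) + 1 + 1) * rin) = X + Δ := by rw [hX, hΔ']; ring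
  rw [hX'] at hc
  -- `⌊(X+Δ)/e⌋ ≥ ⌊X/e⌋ + ⌊Δ/e⌋` and `e⌊Δ/e⌋ ≥ Δ − (e − 1)`
  have hsum : X / e + Δ / e ≤ (X + Δ) / e := by
    refine Int.le_ediv_of_mul_le he ?_
    have h1 := Int.ediv_mul_le X he.ne'
    have h2 := Int.ediv_mul_le Δ he.ne'
    nlinarith
  have hmod : e * (Δ / e) ≥ Δ - (e - 1) := by
    have h1 := Int.mul_ediv_add_emod Δ e
    have h2 := Int.emod_lt_of_pos Δ he
    linarith
  have hfloor : e * (X / e) + e * (Δ / e) ≤ e * ((X + Δ) / e) := by nlinarith [mul_le_mul_of_nonneg_left hsum he.le]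
  nlinarith

/-- **DOWNWARD CLOSURE for heavy laws**: under the hypotheses of `not_cell_succ_of_not_cell` at label `j`, `Cell_{j+1} ⟹ Cell_j`. [folklore] -/
theorem cell_of_cell_succ {f : ℕ → ℤ} {e m δ rin rout : ℤ} (he : 0 < e) (hδ : e - 1 ≤ δ) (hio : rout ≤ rin) (hm : 0 ≤ m)
    {j : ℕ} (hj : 1 ≤ j) (hinc0 : 0 ≤ f (j + 1) - f j) (hinc : 2 * (f j - 1) ≤ (f (j + 1) - f j) * (j : ℤ))
    (h : Cell f 1 e m δ rin rout (j + 1)) : Cell f 1 e m δ rin rout j := by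
  by_contra h'
  exact not_cell_succ_of_not_cell he hδ hio hm hj hinc0 hinc h' h

/-- **PRINT** (`(2j+1)·j ≥ 2(j² − 1)`): `Cell_{j+1} ⟹ Cell_j` — rh2-w-2's `hullCellδ_of_succ` in the `Cell` currency. [folklore] -/
theorem cell_sq_of_succ {e m δ rin rout : ℤ} (he : 0 < e) (hδ : e - 1 ≤ δ) (hio : rout ≤ rin) (hm : 0 ≤ m) {j : ℕ} (hj : 1 ≤ j)
    (h : Cell (fun j => (j : ℤ) ^ 2) 1 e m δ rin rout (j + 1)) : Cell (fun j => (j : ℤ) ^ 2) 1 e m δ rin rout j :=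
  cell_of_cell_succ he hδ hio hm hj (by push_cast; nlinarith) (by push_cast; nlinarith) h

/-- **`κ = 3`** (`lawPow 6 = j³`; `(3j² + 3j + 1)·j ≥ 2(j³ − 1)`): `Cell_{j+1} ⟹ Cell_j` — «seg = 1» is a theorem for this law. [folklore] -/
theorem cell_cube_of_succ {e m δ rin rout : ℤ} (he : 0 < e) (hδ : e - 1 ≤ δ) (hio : rout ≤ rin) (hm : 0 ≤ m) {j : ℕ} (hj : 1 ≤ j)
    (h : Cell (lawPow 6) 1 e m δ rin rout (j + 1)) : Cell (lawPow 6) 1 e m δ rin rout j := by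
  have hj' : (1 : ℤ) ≤ (j : ℤ) := by exact_mod_cast hj
  refine cell_of_cell_succ he hδ hio hm hj ?_ ?_ h
  · rw [lawPow_six, lawPow_six]; push_cast; nlinarith [sq_nonneg (j : ℤ)]
  · rw [lawPow_six, lawPow_six]; push_cast; nlinarith [sq_nonneg (j : ℤ), mul_nonneg (by linarith : (0 : ℤ) ≤ j) (sq_nonneg (j : ℤ))]

/-- **AFFINE `c ≥ 1`** (`den = 1`, `f = c·j²`; `c(2j+1)·j ≥ 2(cj² − 1)`): `Cell_{j+1} ⟹ Cell_j` — «seg = 1» is a theorem for row S-k1-affine2. [folklore] -/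
theorem cell_affine_of_succ {c : ℕ} (hc : 1 ≤ c) {e m δ rin rout : ℤ} (he : 0 < e) (hδ : e - 1 ≤ δ) (hio : rout ≤ rin) (hm : 0 ≤ m)
    {j : ℕ} (hj : 1 ≤ j) (h : Cell (lawAffine c) 1 e m δ rin rout (j + 1)) : Cell (lawAffine c) 1 e m δ rin rout j := by
  have hj' : (1 : ℤ) ≤ (j : ℤ) := by exact_mod_cast hj
  have hc' : (1 : ℤ) ≤ (c : ℤ) := by exact_mod_cast hc
  refine cell_of_cell_succ he hδ hio hm hj ?_ ?_ h
  · unfold lawAffine; push_cast; nlinarith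
  · unfold lawAffine; push_cast; nlinarith

/-! ## §2. The light laws are NOT downward closed: explicit tame-type witnesses -/

/-- **`κ = 1` IS NOT DOWNWARD CLOSED**: at the tame-type integers `(e, m, δ, r_in, r_out) = (7, 13, 6, 1, −3)` (`δ = e − 1`, `r_out ≤ r_in`, `m ≥ 0`) the law
`f(j) = j` licenses labels `1, …, 5` and `7` but NOT `6` — the licensed set `{1,…,5, 7}` is not an initial segment. [folklore] -/
theorem kappaOne_not_downward_closed :
    (∀ i : Fin 5, Cell (fun j => (j : ℤ)) 1 7 13 6 1 (-3) (i.val + 1)) ∧ ¬ Cell (fun j => (j : ℤ)) 1 7 13 6 1 (-3) 6 ∧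
      Cell (fun j => (j : ℤ)) 1 7 13 6 1 (-3) 7 ∧ ¬ Cell (fun j => (j : ℤ)) 1 7 13 6 1 (-3) 8 := by
  unfold Cell
  refine ⟨by decide, by decide, by decide, by decide⟩

/-- `⌈3^{3/2}⌉ = 6` and `⌈4^{3/2}⌉ = 8` by the integer certificates `5² < 27 ≤ 6²`, `7² < 64 ≤ 8²`. [folklore] -/
theorem lawPow_three_at_three_four : lawPow 3 3 = 6 ∧ lawPow 3 4 = 8 := by
  refine ⟨le_antisymm ?_ ?_, le_antisymm ?_ ?_⟩
  · exact_mod_cast (lawPow_le_of_pow_le_sq (a := 3) (j := 3) (s := 6) (by norm_num))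
  · have h := succ_le_lawPow_of_sq_lt (a := 3) (j := 3) (s := 5) (by norm_num); push_cast at h; linarith
  · exact_mod_cast (lawPow_le_of_pow_le_sq (a := 3) (j := 4) (s := 8) (by norm_num))
  · have h := succ_le_lawPow_of_sq_lt (a := 3) (j := 4) (s := 7) (by norm_num); push_cast at h; linarith

/-- **`κ = 3/2` IS NOT DOWNWARD CLOSED**: at the tame-type integers `(e, m, δ, r_in, r_out) = (13, 11, 12, 1, −3)` the law `⌈j^{3/2}⌉` licenses labels `1, 2`
and `4` but NOT `3` (`⌈3^{3/2}⌉ = 6`: `13·⌊26/13⌋ = 26 > 23`; `⌈4^{3/2}⌉ = 8`: `13·⌊35/13⌋ = 26 ≤ 26`). [folklore] -/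
theorem kappaThreeHalves_not_downward_closed :
    Cell (lawPow 3) 1 13 11 12 1 (-3) 1 ∧ Cell (lawPow 3) 1 13 11 12 1 (-3) 2 ∧ ¬ Cell (lawPow 3) 1 13 11 12 1 (-3) 3 ∧
      Cell (lawPow 3) 1 13 11 12 1 (-3) 4 := by
  obtain ⟨h3, h4⟩ := lawPow_three_at_three_four
  have h1 : lawPow 3 1 = 1 := lawPow_at_one 3
  have h2 : lawPow 3 2 = 3 := by
    refine le_antisymm ?_ ?_
    · exact_mod_cast (lawPow_le_of_pow_le_sq (a := 3) (j := 2) (s := 3) (by norm_num))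
    · have h := succ_le_lawPow_of_sq_lt (a := 3) (j := 2) (s := 2) (by norm_num); push_cast at h; linarith
  refine ⟨?_, ?_, ?_, ?_⟩
  · rw [cell_congr (g := fun _ => (1 : ℤ)) h1]; unfold Cell; decide
  · rw [cell_congr (g := fun _ => (3 : ℤ)) h2]; unfold Cell; decide
  · rw [cell_congr (g := fun _ => (6 : ℤ)) h3]; unfold Cell; decide
  · rw [cell_congr (g := fun _ => (8 : ℤ)) h4]; unfold Cell; decide

/-- Consequently the `κ = 1` witness place has `T ≠ demandSum L − demandSum j₀` for any single cutoff: its unlicensed set on `{1..7}` is `{6}`, so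
`T_{κ=1} = 6 − 1 = 5` while `K_L0` counts label `7` (`keptDemand = Σ_{j ∈ {1..5,7}} (j − 1) = 16`): the segment-free definitions of part 3a are the ones that
match the engines' «kept = licensed cells». [folklore] -/
theorem kappaOne_witness_offDemand :
    offDemand (fun j => (j : ℤ)) 1 7 13 6 1 (-3) 7 = 5 ∧ keptDemand (fun j => (j : ℤ)) 1 7 13 6 1 (-3) 7 = 16 := by
  obtain ⟨h15, h6, h7, -⟩ := kappaOne_not_downward_closed
  have hcell : ∀ i, i < 7 → (Cell (fun j => (j : ℤ)) 1 7 13 6 1 (-3) (i + 1) ↔ i ≠ 5) := by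
    intro i hi
    interval_cases i
    · exact ⟨fun _ => by omega, fun _ => h15 ⟨0, by omega⟩⟩
    · exact ⟨fun _ => by omega, fun _ => h15 ⟨1, by omega⟩⟩
    · exact ⟨fun _ => by omega, fun _ => h15 ⟨2, by omega⟩⟩
    · exact ⟨fun _ => by omega, fun _ => h15 ⟨3, by omega⟩⟩
    · exact ⟨fun _ => by omega, fun _ => h15 ⟨4, by omega⟩⟩
    · exact ⟨fun h => absurd h h6, fun h => absurd rfl h⟩
    · exact ⟨fun _ => by omega, fun _ => h7⟩
  have hoff : offDemand (fun j => (j : ℤ)) 1 7 13 6 1 (-3) 7 = 5 := by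
    unfold offDemand
    rw [Finset.sum_eq_single_of_mem 5 (by simp) (fun i hi hne => by
      rw [Finset.mem_range] at hi
      rw [if_pos ((hcell i hi).2 hne)])]
    rw [if_neg (fun hc => ((hcell 5 (by omega)).1 hc) rfl)]
    norm_num
  refine ⟨hoff, ?_⟩
  have hsum := keptDemand_add_offDemand (fun j => (j : ℤ)) 1 7 13 6 1 (-3) 7
  have hD := two_mul_demandSum_id 7
  push_cast at hD
  linarith

end Summit.ABC.IUTFork.Repair.RH.ReqsideWeightLaws

end
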